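import Literature.MathematicalPhysics.QuantumFieldTheory.Balaban1983to89.B13Contraction113

/-!
# `Balaban1983to89.B11Eq63FunctionalDerivative` — T. Bałaban, *The variational problem and background fields in renormalization group method for lattice gauge theories*, Commun. Math. Phys. **102** (1985) 277–309 [Balaban1985Variational]: (63)–(69) pp. 287–288 and (70) p. 289 — the functional derivative `𝔇(A′) = (δ/δA′)D(A′)` of the solution `D` of the fixed-point equation (49): its EXISTENCE as a (strict) Fréchet derivative together with the formula (70) PROVED by the implicit function theorem; the integral equation (65)/(67)/(68) «obtained by differentiation of Eq. (49)» PROVED by the chain rule; its kernel form (64)/(66) PROVED; the Cauchy step (69) PROVED (theorem-only module over abstract normed spaces)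

statement-level skeleton of published theorems with citation tags; proofs where landed; nothing here is a claim about the Yang–Mills mass gap

PDF held: `paper:balaban1985-cmp102-variational-background` (journal page = PDF page + 276).  Renders
`run/shared/lean/pub/pub-balaban/b2b-balaban-ref1/pages/1985-cmp102-variational-background/…-p011-x2.png` (p. 287),
`…-p012-x2.png` (p. 288), `…-p013-x2.png` (p. 289) READ AS IMAGES by this seat (lit-balaban reader/typer r08, gen 3,
2026-08-21).

CITATION HEADER (lean-in-tree rule 2026-08-18).  WHAT IS REPRODUCED: SKELETON row `B11.Eq63` = displays (63)–(69)
(Sect. C, the functional derivative `𝔇` of the linearizing transformation's `D`), and the solution formula (70) of row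
`B11.Eq70` (whose KERNEL bound (71) is `B11SectG.neumann_majorant`, not repeated).  Sibling modules: `B13Contraction113`
(the fixed point of (49)/(50): (53)–(55), (57), existence, uniqueness, analyticity in one complex parameter — imported
for the hypothesis structure `QuadAnalytic` = «|C_j(X)| ≦ C₂|X|², C_j analytic» of [4] Props. 4/7), `B11SectG` ((70)–(71)
as block-kernel majorants, (182)–(190)), `B11.lean` (`B11.Prop3Printed`, the carrier field `LGData.kerD` = sup_b |𝔇(A′; c, b)|).

THE PRINT (pp. 287–289 [PDF 11–13], verbatim from the renders).  p. 287: «More precisely this property can be formulated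
in terms of decay properties of a functional derivative of D(A′). The functional derivative is a kernel of the linear
operator acting on functions δA′ and defined as
  ⟨(δ/δA′) D(A′), δA′⟩ = (d/dτ) D(A′ + τδA′)|_{τ=0}. (63)
The functions δA′ are defined at bonds of Ω₀, and values of this linear operator are functions defined at bonds of 𝔅_k.
Let us denote
  𝔇(A′; c, b) = (δ/δA′(b)) D(A′, c). (64)
We will prove that this function has an exponential decay. It satisfies an integral equation which can be obtained by
differentiation of Eq. (49):
  ⟨(δC_j/δA)(Lʲη(A′ − HD(A′))), Lʲη(δA′ − H⟨(δ/δA′)D(A′), δA′⟩)⟩ = ⟨(δ/δA′)D(A′), δA′⟩ (65)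
hence
  Lʲη (δC_j/δA(b))(Lʲη(A′ − HD(A′)), c)
    − Lʲη Σ_{b′} η^d (δC_j/δA(b′))(Lʲη(A′ − HD(A′)), c) Σ_{c′∈𝔅_k} (L^{j′}η)^d H(b′, c′)𝔇(A′; c′, b) = 𝔇(A′; c, b),
      c ∈ Λ_j, b ∈ Ω₀, (66)
where we have suppressed matrix indices of operators acting on the Lie algebra valued functions. We may write this
equation in the form
  Lʲη (δC_j/δA)(Lʲη(A′ − HD(A′))) − Lʲη⟨(δC_j/δA)(Lʲη(A′ − HD(A′))), H𝔇(A′)⟩ = 𝔇(A′) on Λ_j. (67)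
This gives the following equation on 𝔇:
  [I + Lʲη⟨(δC_j/δA)(Lʲη(A′ − HD(A′))), H⟩] 𝔇(A′) = Lʲη (δC_j/δA)(Lʲη(A′ − HD(A′))) on Λ_j. (68)
As it is easily seen from (66) this equation is an equation on 𝔇 as a function of the variable c ∈ 𝔅_k. The variable b
is fixed and treated as a parameter. We have the bound
  |(Lʲη⟨(δC_j/δA)(Lʲη(A′ − HD(A′))), H⟩)(c, c′)| = |(d/dτ) C_j(Lʲη(A′ − HD(A′)) + τH(·, c′), c)|_{τ=0}|
    = |(1/2πi) ∮_{|τ|=r} dτ τ⁻² C_j(Lʲη(A′ − HD(A′)) + τH(·, c′), c)|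
    ≤ (1/r) C₂ (2ε₃ + r sup_{b ⊂ Bʲ(c₋)∪Bʲ(c₊)} Lʲη|H(b, c′)|)²
    ≤ (1/r) C₂ (2ε₃ + rB₀(L^{j′}η)^{−d}e^{−δ₀d(c₋,c′₋)})² = 9C₂B₀ε₃(L^{j′}η)^{−d}e^{−δ₀d(c₋,c′₋)}, (69)
where we have taken r = ε₃(B₀(L^{j′}η)^{−d}e^{−δ₀d(c₋,c′₋)})⁻¹, c ∈ Λ_j, c′ ∈ Λ_{j′}, (see [3] for a definition of the
distance d(y, y′), y, y′ ∈ 𝔅_k). The above bound shows that the operator in the square bracket in (68) (without the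
identity operator) is of the same type as the operators R studied in [3, 5]. Let us denote it by ℜ. Equation (68) is
uniquely solvable by a convergent Neumann series,
  𝔇(A′) = (I + ℜ)⁻¹ L^{j(·)}η ((δ/δA) C)(A′ − HD(A′)), (70)
where j(c) = j for c ∈ Λ_j, and C(A, c) = C_j(LʲηA, c) for c ∈ Λ_j.»  And (49) p. 285: «D(A′) = C_j(LʲηA′ − LʲηHD(A′))
on Λ_j»; p. 286: «This solution is a limit of uniformly convergent sequence of successive approximations and it is an
analytic function of A′»; (57) p. 286: «|A| ≦ … < 2ε₃(Lʲη)⁻¹ on Ω_j» for A = A′ − HD(A′).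

DICTIONARY (abstract; nothing re-declared).  `E` = the space of fields `A′` (functions on bonds of `Ω₀`), `F` = the space
of the values `D(A′)`, `X` (functions on `𝔅_k`) — normed spaces over a field `𝕜` (`ℝ` or `ℂ`; the print's `A′` is
`gᶜ`-valued), complete where the implicit function theorem is invoked.  `𝒞 : E → F` = the print's RESCALED functional
`C` of p. 289 («C(A, c) = C_j(LʲηA, c) for c ∈ Λ_j», the scale `L^{j(·)}η` absorbed exactly as in `B13Contraction113`),
so that (49) reads `D(A′) = 𝒞(A′ − H(D(A′)))`; `𝒞′ : E →L[𝕜] F` = its Fréchet derivative at `X₀ = A′ − HD(A′)` (the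
print's `Lʲη(δC_j/δA)(Lʲη(A′ − HD(A′)))` = the right-hand side of (68), read as the linear operator `δA ↦ ⟨δC/δA, δA⟩`);
`H : F →L[𝕜] E` = the operator `H` of (45); `ℜ = 𝒞′ ∘ H : F →L[𝕜] F` = «the operator in the square bracket in (68)
(without the identity operator)»; `𝔇 : E →L[𝕜] F` = `(δ/δA′)D(A′)`.  «Functional derivative» (63) = Fréchet / line
derivative (Mathlib `HasFDerivAt`, `HasLineDerivAt`); in §4 the KERNELS of (64)/(66) are taken with respect to the
printed pairings: `η^d` on bonds of `Ω₀` (weight `wE`), `(L^{j′}η)^d` on points of `𝔅_k` (weight `wF`) — i.e.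
`⟨(δ/δA′)D(A′), δA′⟩(c) = Σ_b η^d 𝔇(A′; c, b) δA′(b)`, `(Hg)(b′) = Σ_{c′} (L^{j′}η)^d H(b′, c′) g(c′)`,
`⟨(δC/δA)(X₀), f⟩(c) = Σ_{b′} η^d (δC/δA(b′))(X₀, c) f(b′)` (these three expansions are the hypotheses `hDk`, `hHk`,
`hCk`; Lie-algebra «matrix indices suppressed» as in the print: scalar kernels).

WHAT IS CERTIFIED (kernel, sorry-free; axioms `propext` / `Classical.choice` / `Quot.sound`).
§1 **(63)** `eq63`: a Fréchet derivative `𝔇` of `D` at `A′` gives `(d/dτ)D(A′ + τδA′)|_{τ=0} = 𝔇δA′` (`eq63_deriv`).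
§2 **(65)/(67)/(68) «by differentiation of Eq. (49)»** `eq67`: if (49) holds near `A′`, `D` has Fréchet derivative `𝔇`
at `A′` and `𝒞` has Fréchet derivative `𝒞′` at `X₀`, then `𝒞′ ∘ (I − H𝔇) = 𝔇` (chain rule + uniqueness of the
derivative); pointwise **(65)** `eq65`; **(68)** `eq68` `(I + ℜ)𝔇 = 𝒞′`; the column reading «equation on 𝔇 as a
function of c, b a parameter» `eq68_column`; uniqueness of the solution of (68) for invertible `I + ℜ` (`eq68_unique`).
§3 **EXISTENCE of (63) and (70)** `hasStrictFDerivAt_of_eq49`: if (49) holds near `A′`, `𝒞` is strictly differentiable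
at `X₀` (e.g. analytic, p. 285), `D` is continuous at `A′` (p. 286: the fixed point of a uniform contraction —
`continuousAt_of_contraction` / `continuousAt_of_eq49` discharge it from the contraction (54)) and `I + ℜ` is invertible, then `D` is
strictly Fréchet-differentiable at `A′` with derivative `(I + ℜ)⁻¹𝒞′` — Mathlib's implicit function theorem
`HasStrictFDerivAt.implicitFunctionOfProdDomain` applied to `Φ(A′, X) = X − 𝒞(A′ − HX)`, whose partial derivative in
`X` is `I + ℜ`, plus the identification of `D` with the implicit function near `A′`; **(70)** `eq70`
(`fderiv D A′ = (I + ℜ)⁻¹𝒞′`); the Neumann series «(68) is uniquely solvable by a convergent Neumann series» for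
`‖ℜ‖ < 1`: `isInvertible_one_add_of_norm_lt_one`, `inverse_one_add_eq_tsum` (`(I + ℜ)⁻¹ = Σₙ (−ℜ)ⁿ`), `eq70_neumann`.
§4 **(64)/(66)** `eq66`: the kernel identity (66), for kernels relative to the weighted pairings, from (67).
§5 **(69)** `norm_deriv_le_69` (Cauchy's estimate `‖(d/dτ)f(0)‖ ≤ (sup_{|τ|=r}‖f‖)/r` with the printed bound
`C₂(2ε₃ + rM)²` on the circle and the printed radius `r = ε₃/M`: `= 9C₂ε₃M`), `ineq69` (the same from
`B13Contraction113.QuadAnalytic C C₂ R`, `‖X₀‖ ≤ 2ε₃` (57), `‖h‖ ≤ M`, `3ε₃ < R`), `ineq69_printed` (`M =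
B₀(L^{j′}η)^{−d}e^{−δ₀d(c₋,c′₋)}` literally), `eq69_line1` ((69) line 1 = (63) for `C_j`), `eq69_cauchyFormula`
((69) line 2: the derivative as `(1/2πi)∮ τ⁻² …`, Mathlib's Cauchy formula), `radius69` (the printed `r`).

HONEST SCOPE — what is NOT claimed.  (i) The lattice objects (`C_j` of [4], `H` of [5], the sets `Λ_j`, `𝔅_k`) are NOT
constructed: `𝒞`, `H`, `D` are abstract; (49), the differentiability/analyticity of `𝒞` ([4] Props. 4/7, cell GAPS
G-B7-05 / G-B11-C1), the continuity of `D` (or the contraction data feeding `continuousAt_of_contraction`) and the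
invertibility of `I + ℜ` (in print: from (69) + Lemma 2.1 [3] ⇒ (71), `B11SectG.neumann_majorant`) are HYPOTHESES
stated in print's letters.  (ii) (69) certifies the Cauchy step and its arithmetic; the kernel bound on `H`,
«sup_{b ⊂ Bʲ(c₋)∪Bʲ(c₊)} Lʲη|H(b, c′)| ≤ B₀(L^{j′}η)^{−d}e^{−δ₀d(c₋,c′₋)}» ([5] Thm. 3.12 / (3.132)), is the hypothesis
`‖h‖ ≤ M`.  (iii) (71)–(73) are rows `B11.Eq70`/`B11.Eq72`/`B11.Eq73` (not here).  (iv) «matrix indices suppressed»: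
§4 is typed with scalar kernels over a field; the `gᶜ ⊗ gᶜ`-matrix version is the same identity entrywise and is not
separately typed.  (v) Nothing here is progress on the summit `Summit.QuantumFields`.  Unit `lit-balaban-r08` gen 3 (row
`B11.Eq63` of `HOME/lit-balaban-r08/ROWS-B11.md`, HOME = `run/shared/lean/pub/lit-balaban/`).
-/

namespace Literature.MathematicalPhysics.QuantumFieldTheory.Balaban1983to89.B11Eq63FunctionalDerivative

open Filter Topology Metric Set

/-! ## §1 (63): the functional derivative is the derivative along lines -/
section Eq63

variable {𝕜 : Type*} [NontriviallyNormedField 𝕜] {E F : Type*} [NormedAddCommGroup E] [NormedSpace 𝕜 E]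
  [NormedAddCommGroup F] [NormedSpace 𝕜 F]

/-- **(63)** «⟨(δ/δA′)D(A′), δA′⟩ = (d/dτ)D(A′ + τδA′)|_{τ=0}»: the Fréchet derivative `𝔇 = (δ/δA′)D(A′)` tested on a
direction `δA′` is the derivative of `τ ↦ D(A′ + τδA′)` at `τ = 0` (Mathlib `HasFDerivAt.hasLineDerivAt`).
[cite: Balaban1985Variational, (63) p.287] -/
theorem eq63 {D : E → F} {𝔇 : E →L[𝕜] F} {A' : E} (hD : HasFDerivAt D 𝔇 A') (δ : E) :
    HasDerivAt (fun τ : 𝕜 => D (A' + τ • δ)) (𝔇 δ) 0 :=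
  hD.hasLineDerivAt δ

/-- (63), `deriv` form: `(d/dτ)D(A′ + τδA′)|_{τ=0} = 𝔇δA′`. [cite: Balaban1985Variational, (63) p.287] -/
theorem eq63_deriv {D : E → F} {𝔇 : E →L[𝕜] F} {A' : E} (hD : HasFDerivAt D 𝔇 A') (δ : E) :
    deriv (fun τ : 𝕜 => D (A' + τ • δ)) 0 = 𝔇 δ :=
  (eq63 hD δ).deriv

end Eq63

/-! ## §2 (65), (67), (68): differentiation of the fixed-point equation (49) -/
section Eq67

variable {𝕜 : Type*} [NontriviallyNormedField 𝕜] {E F : Type*} [NormedAddCommGroup E] [NormedSpace 𝕜 E]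
  [NormedAddCommGroup F] [NormedSpace 𝕜 F]
variable {𝒞 : E → F} {𝒞' : E →L[𝕜] F} {H : F →L[𝕜] E} {D : E → F} {𝔇 : E →L[𝕜] F} {A' : E}

/-- **(67)** «Lʲη(δC_j/δA)(Lʲη(A′ − HD(A′))) − Lʲη⟨(δC_j/δA)(Lʲη(A′ − HD(A′))), H𝔇(A′)⟩ = 𝔇(A′)», i.e.
`𝒞′ ∘ (I − H𝔇) = 𝔇`, «obtained by differentiation of Eq. (49)»: if (49) `D(A″) = 𝒞(A″ − HD(A″))` holds for `A″` near
`A′`, `D` has Fréchet derivative `𝔇` at `A′` and `𝒞` has Fréchet derivative `𝒞′` at `X₀ = A′ − HD(A′)`, the chain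
rule and the uniqueness of the derivative give the identity. [cite: Balaban1985Variational, (67) p.288] -/
theorem eq67 (h49 : ∀ᶠ A'' in 𝓝 A', D A'' = 𝒞 (A'' - H (D A''))) (hD : HasFDerivAt D 𝔇 A')
    (h𝒞 : HasFDerivAt 𝒞 𝒞' (A' - H (D A'))) :
    𝒞' ∘L (ContinuousLinearMap.id 𝕜 E - H ∘L 𝔇) = 𝔇 := by
  have h1 : HasFDerivAt (fun A'' => A'' - H (D A'')) (ContinuousLinearMap.id 𝕜 E - H ∘L 𝔇) A' :=
    (hasFDerivAt_id A').sub (H.hasFDerivAt.comp A' hD)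
  have h2 : HasFDerivAt (fun A'' => 𝒞 (A'' - H (D A'')))
      (𝒞' ∘L (ContinuousLinearMap.id 𝕜 E - H ∘L 𝔇)) A' := h𝒞.comp A' h1
  have h3 : HasFDerivAt D (𝒞' ∘L (ContinuousLinearMap.id 𝕜 E - H ∘L 𝔇)) A' :=
    h2.congr_of_eventuallyEq h49
  exact h3.unique hD

/-- **(65)** «⟨(δC_j/δA)(Lʲη(A′ − HD(A′))), Lʲη(δA′ − H⟨(δ/δA′)D(A′), δA′⟩)⟩ = ⟨(δ/δA′)D(A′), δA′⟩», the same
identity tested on a direction `δA′`. [cite: Balaban1985Variational, (65) p.288] -/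
theorem eq65 (h49 : ∀ᶠ A'' in 𝓝 A', D A'' = 𝒞 (A'' - H (D A''))) (hD : HasFDerivAt D 𝔇 A')
    (h𝒞 : HasFDerivAt 𝒞 𝒞' (A' - H (D A'))) (δ : E) :
    𝒞' (δ - H (𝔇 δ)) = 𝔇 δ := by
  have h := DFunLike.congr_fun (eq67 h49 hD h𝒞) δ
  simpa using h

/-- **(68)** «[I + Lʲη⟨(δC_j/δA)(Lʲη(A′ − HD(A′))), H⟩]𝔇(A′) = Lʲη(δC_j/δA)(Lʲη(A′ − HD(A′)))», i.e.
`(I + ℜ)𝔇 = 𝒞′` with `ℜ = 𝒞′ ∘ H` «the operator in the square bracket (without the identity operator)».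
[cite: Balaban1985Variational, (68) p.288] -/
theorem eq68 (h49 : ∀ᶠ A'' in 𝓝 A', D A'' = 𝒞 (A'' - H (D A''))) (hD : HasFDerivAt D 𝔇 A')
    (h𝒞 : HasFDerivAt 𝒞 𝒞' (A' - H (D A'))) :
    (1 + 𝒞' ∘L H) ∘L 𝔇 = 𝒞' := by
  ext δ
  have h := eq65 h49 hD h𝒞 δ
  rw [map_sub] at h
  change 𝔇 δ + 𝒞' (H (𝔇 δ)) = 𝒞' δ
  exact (sub_eq_iff_eq_add.mp h).symm

/-- (68) ⇔ (67): for ANY linear `𝔇`, `(I + 𝒞′H)𝔇 = 𝒞′` iff `𝒞′(I − H𝔇) = 𝔇` (pure algebra).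
[cite: Balaban1985Variational, (67)-(68) p.288] -/
theorem eq68_iff_eq67 (𝒞' : E →L[𝕜] F) (H : F →L[𝕜] E) (𝔇 : E →L[𝕜] F) :
    (1 + 𝒞' ∘L H) ∘L 𝔇 = 𝒞' ↔ 𝒞' ∘L (ContinuousLinearMap.id 𝕜 E - H ∘L 𝔇) = 𝔇 := by
  constructor
  · intro h
    ext δ
    have hδ := DFunLike.congr_fun h δ
    change 𝔇 δ + 𝒞' (H (𝔇 δ)) = 𝒞' δ at hδ
    change 𝒞' (δ - H (𝔇 δ)) = 𝔇 δ
    rw [map_sub]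
    exact sub_eq_iff_eq_add.mpr hδ.symm
  · intro h
    ext δ
    have hδ := DFunLike.congr_fun h δ
    change 𝒞' (δ - H (𝔇 δ)) = 𝔇 δ at hδ
    rw [map_sub] at hδ
    change 𝔇 δ + 𝒞' (H (𝔇 δ)) = 𝒞' δ
    exact (sub_eq_iff_eq_add.mp hδ).symm

/-- «As it is easily seen from (66) this equation is an equation on 𝔇 as a function of the variable c ∈ 𝔅_k. The
variable b is fixed and treated as a parameter»: (68) holds column by column — for every direction `e` (a basis field
at the bond `b`) the column `𝔇e ∈ F` solves `(I + ℜ)(𝔇e) = 𝒞′e`. [cite: Balaban1985Variational, (68) p.288] -/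
theorem eq68_column {𝒞' : E →L[𝕜] F} {H : F →L[𝕜] E} {𝔇 : E →L[𝕜] F} (h68 : (1 + 𝒞' ∘L H) ∘L 𝔇 = 𝒞') (e : E) :
    (1 + 𝒞' ∘L H) (𝔇 e) = 𝒞' e :=
  DFunLike.congr_fun h68 e

/-- «Equation (68) is uniquely solvable»: for invertible `I + ℜ` the solution of (68) is unique and equals
`(I + ℜ)⁻¹𝒞′` (= (70)). [cite: Balaban1985Variational, (68)-(70) pp.288-289] -/
theorem eq68_unique {𝒞' : E →L[𝕜] F} {H : F →L[𝕜] E} {𝔇 : E →L[𝕜] F}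
    (hinv : (1 + 𝒞' ∘L H).IsInvertible) (h68 : (1 + 𝒞' ∘L H) ∘L 𝔇 = 𝒞') :
    𝔇 = (1 + 𝒞' ∘L H).inverse ∘L 𝒞' := by
  calc 𝔇 = ((1 + 𝒞' ∘L H).inverse ∘L (1 + 𝒞' ∘L H)) ∘L 𝔇 := by
        rw [hinv.inverse_comp_self, ContinuousLinearMap.id_comp]
    _ = (1 + 𝒞' ∘L H).inverse ∘L ((1 + 𝒞' ∘L H) ∘L 𝔇) := by rw [ContinuousLinearMap.comp_assoc]
    _ = (1 + 𝒞' ∘L H).inverse ∘L 𝒞' := by rw [h68]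

end Eq67

/-! ## §3 Existence of the functional derivative and the formula (70) -/
section Eq70

variable {𝕜 : Type*} [NontriviallyNormedField 𝕜] {E F : Type*} [NormedAddCommGroup E] [NormedSpace 𝕜 E]
  [NormedAddCommGroup F] [NormedSpace 𝕜 F]

/-- **Continuity of the fixed point** (p. 286: «This solution is a limit of uniformly convergent sequence of successive
approximations …»; what §3 consumes): if near `A′` the map `D` is a fixed point `D(A″) = T(A″, D(A″))` of a family of
maps that are `q`-Lipschitz, `q < 1`, on a set containing the values `D(A″)` (the contraction (54): `q = 9C₂B₀ε₃ ≤ ½`),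
and `A″ ↦ T(A″, D(A′))` is continuous at `A′`, then `D` is continuous at `A′`:
`‖D(A″) − D(A′)‖ ≤ (1 − q)⁻¹‖T(A″, D(A′)) − T(A′, D(A′))‖`. [cite: Balaban1985Variational, (54) p.286] -/
theorem continuousAt_of_contraction {T : E → F → F} {D : E → F} {S : Set F} {q : ℝ} {A' : E} (hq : q < 1)
    (hfix : ∀ᶠ A'' in 𝓝 A', T A'' (D A'') = D A'') (hS : ∀ᶠ A'' in 𝓝 A', D A'' ∈ S)
    (hlip : ∀ᶠ A'' in 𝓝 A', ∀ X ∈ S, ∀ X' ∈ S, ‖T A'' X - T A'' X'‖ ≤ q * ‖X - X'‖)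
    (hT : ContinuousAt (fun A'' => T A'' (D A')) A') : ContinuousAt D A' := by
  have hfix0 : T A' (D A') = D A' := hfix.self_of_nhds
  have hS0 : D A' ∈ S := hS.self_of_nhds
  have hq1 : 0 < 1 - q := sub_pos.mpr hq
  -- the basic estimate, eventually in A''
  have hest : ∀ᶠ A'' in 𝓝 A', ‖D A'' - D A'‖ ≤ (1 - q)⁻¹ * ‖T A'' (D A') - T A' (D A')‖ := by
    filter_upwards [hfix, hS, hlip] with A'' h1 h2 h3
    have h4 : ‖D A'' - D A'‖ ≤ q * ‖D A'' - D A'‖ + ‖T A'' (D A') - T A' (D A')‖ := by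
      calc ‖D A'' - D A'‖ = ‖(T A'' (D A'') - T A'' (D A')) + (T A'' (D A') - T A' (D A'))‖ := by
            rw [h1, hfix0]; congr 1; abel
        _ ≤ ‖T A'' (D A'') - T A'' (D A')‖ + ‖T A'' (D A') - T A' (D A')‖ := norm_add_le _ _
        _ ≤ q * ‖D A'' - D A'‖ + ‖T A'' (D A') - T A' (D A')‖ := by
            gcongr; exact h3 _ h2 _ hS0
    have h5 : (1 - q) * ‖D A'' - D A'‖ ≤ ‖T A'' (D A') - T A' (D A')‖ := by linarith
    calc ‖D A'' - D A'‖ = (1 - q)⁻¹ * ((1 - q) * ‖D A'' - D A'‖) := by field_simp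
      _ ≤ (1 - q)⁻¹ * ‖T A'' (D A') - T A' (D A')‖ :=
          mul_le_mul_of_nonneg_left h5 (inv_nonneg.mpr hq1.le)
  -- the right-hand side tends to 0
  have hT0 : Tendsto (fun A'' => (1 - q)⁻¹ * ‖T A'' (D A') - T A' (D A')‖) (𝓝 A') (𝓝 0) := by
    have h1 : Tendsto (fun A'' => T A'' (D A') - T A' (D A')) (𝓝 A') (𝓝 0) := by
      have := hT.tendsto.sub_const (T A' (D A'))
      simpa using this
    have h2 := h1.norm
    simpa using h2.const_mul (1 - q)⁻¹
  have hD0 : Tendsto (fun A'' => D A'' - D A') (𝓝 A') (𝓝 0) := squeeze_zero_norm' hest hT0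
  have := hD0.add_const (D A')
  simp only [sub_add_cancel, zero_add] at this
  exact this

/-- The same for the transformation (50) `X ↦ 𝒞(A″ − HX)` of which `D(A″)` is the fixed point ((49)), with the
contraction estimate (54) «|C_j(LʲηA′ − LʲηHX₁) − C_j(LʲηA′ − LʲηHX₂)| ≦ 9C₂B₀ε₃|X₁ − X₂|» (`q = 9C₂B₀ε₃ ≦ ½`) on a set
`S` containing the values and `𝒞` continuous at `X₀ = A′ − HD(A′)`: `D` is continuous at `A′`.
[cite: Balaban1985Variational, (49)-(50) p.285, (54) p.286] -/
theorem continuousAt_of_eq49 {𝒞 : E → F} {H : F →L[𝕜] E} {D : E → F} {S : Set F} {q : ℝ} {A' : E} (hq : q < 1)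
    (h49 : ∀ᶠ A'' in 𝓝 A', D A'' = 𝒞 (A'' - H (D A''))) (hS : ∀ᶠ A'' in 𝓝 A', D A'' ∈ S)
    (h54 : ∀ᶠ A'' in 𝓝 A', ∀ X ∈ S, ∀ X' ∈ S, ‖𝒞 (A'' - H X) - 𝒞 (A'' - H X')‖ ≤ q * ‖X - X'‖)
    (h𝒞 : ContinuousAt 𝒞 (A' - H (D A'))) : ContinuousAt D A' := by
  refine continuousAt_of_contraction (T := fun A'' X => 𝒞 (A'' - H X)) hq ?_ hS h54 ?_
  · filter_upwards [h49] with A'' h using h.symm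
  · have hin : ContinuousAt (fun A'' : E => A'' - H (D A')) A' := continuousAt_id.sub continuousAt_const
    exact ContinuousAt.comp_of_eq h𝒞 hin rfl

variable [CompleteSpace E] [CompleteSpace F]
variable {𝒞 : E → F} {𝒞' : E →L[𝕜] F} {H : F →L[𝕜] E} {D : E → F} {A' : E}

/-- **Existence of the functional derivative (63) and the formula (70)** «𝔇(A′) = (I + ℜ)⁻¹L^{j(·)}η((δ/δA)C)(A′ −
HD(A′))».  If (49) `D(A″) = 𝒞(A″ − HD(A″))` holds for `A″` near `A′`, `𝒞` is strictly differentiable at `X₀ = A′ −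
HD(A′)` with derivative `𝒞′` (it is analytic, p. 285), `D` is continuous at `A′` (p. 286) and `I + ℜ`, `ℜ = 𝒞′H`, is
invertible ((69), (71)), then `D` is strictly Fréchet-differentiable at `A′` and `(δ/δA′)D(A′) = (I + ℜ)⁻¹𝒞′`.
Proof: the implicit function theorem for `Φ(A″, X) = X − 𝒞(A″ − HX)` at `(A′, D(A′))` — its partial derivative in `X`
is `I + ℜ`, in `A″` it is `−𝒞′` — and the identification of `D` with the implicit function near `A′` (by (49) and the
continuity of `D`). [cite: Balaban1985Variational, (63) p.287, (70) p.289] -/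
theorem hasStrictFDerivAt_of_eq49 (h49 : ∀ᶠ A'' in 𝓝 A', D A'' = 𝒞 (A'' - H (D A'')))
    (h𝒞 : HasStrictFDerivAt 𝒞 𝒞' (A' - H (D A'))) (hDc : ContinuousAt D A')
    (hinv : (1 + 𝒞' ∘L H).IsInvertible) :
    HasStrictFDerivAt D ((1 + 𝒞' ∘L H).inverse ∘L 𝒞') A' := by
  -- the defining map and its strict derivative at `u = (A′, D A′)`
  let Φ : E × F → F := fun v => v.2 - 𝒞 (v.1 - H v.2)
  let Φ' : E × F →L[𝕜] F := ContinuousLinearMap.snd 𝕜 E F -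
    𝒞' ∘L (ContinuousLinearMap.fst 𝕜 E F - H ∘L ContinuousLinearMap.snd 𝕜 E F)
  have hΦ : HasStrictFDerivAt Φ Φ' (A', D A') := by
    have h1 : HasStrictFDerivAt (fun v : E × F => v.1 - H v.2)
        (ContinuousLinearMap.fst 𝕜 E F - H ∘L ContinuousLinearMap.snd 𝕜 E F) (A', D A') :=
      hasStrictFDerivAt_fst.sub (H.hasStrictFDerivAt.comp _ hasStrictFDerivAt_snd)
    have h2 : HasStrictFDerivAt (fun v : E × F => 𝒞 (v.1 - H v.2))
        (𝒞' ∘L (ContinuousLinearMap.fst 𝕜 E F - H ∘L ContinuousLinearMap.snd 𝕜 E F)) (A', D A') :=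
      h𝒞.comp (A', D A') h1
    exact hasStrictFDerivAt_snd.sub h2
  have hinr : Φ' ∘L ContinuousLinearMap.inr 𝕜 E F = 1 + 𝒞' ∘L H := by
    ext X
    simp [Φ']
  have hinl : Φ' ∘L ContinuousLinearMap.inl 𝕜 E F = -𝒞' := by
    ext δ
    simp [Φ']
  have if₂ : (Φ' ∘L ContinuousLinearMap.inr 𝕜 E F).IsInvertible := by rw [hinr]; exact hinv
  -- the implicit function and its derivative
  have hψ' := hΦ.hasStrictFDerivAt_implicitFunctionOfProdDomain if₂
  rw [hinr, hinl] at hψ'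
  have hderiv : -(1 + 𝒞' ∘L H).inverse ∘L (-𝒞') = (1 + 𝒞' ∘L H).inverse ∘L 𝒞' := by
    ext δ; simp
  rw [hderiv] at hψ'
  -- `D` coincides with the implicit function near `A′`
  have hiff := hΦ.eventually_apply_eq_iff_implicitFunctionOfProdDomain if₂
  have hΦ0 : ∀ᶠ A'' in 𝓝 A', Φ (A'', D A'') = 0 := by
    filter_upwards [h49] with A'' h
    change D A'' - 𝒞 (A'' - H (D A'')) = 0
    exact sub_eq_zero.mpr h
  have hΦu : Φ (A', D A') = 0 := hΦ0.self_of_nhds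
  have ht : Tendsto (fun A'' => (A'', D A'')) (𝓝 A') (𝓝 (A', D A')) :=
    (continuousAt_id.prodMk hDc).tendsto
  have hev : ∀ᶠ A'' in 𝓝 A', hΦ.implicitFunctionOfProdDomain if₂ A'' = D A'' := by
    filter_upwards [ht.eventually hiff, hΦ0] with A'' h1 h2
    exact h1.mp (by rw [h2, hΦu])
  exact hψ'.congr_of_eventuallyEq hev

/-- (63) exists: under the hypotheses of `hasStrictFDerivAt_of_eq49`, `D` is Fréchet-differentiable at `A′` with
derivative `𝔇 = (I + ℜ)⁻¹𝒞′`. [cite: Balaban1985Variational, (63) p.287, (70) p.289] -/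
theorem hasFDerivAt_of_eq49 (h49 : ∀ᶠ A'' in 𝓝 A', D A'' = 𝒞 (A'' - H (D A'')))
    (h𝒞 : HasStrictFDerivAt 𝒞 𝒞' (A' - H (D A'))) (hDc : ContinuousAt D A')
    (hinv : (1 + 𝒞' ∘L H).IsInvertible) :
    HasFDerivAt D ((1 + 𝒞' ∘L H).inverse ∘L 𝒞') A' :=
  (hasStrictFDerivAt_of_eq49 h49 h𝒞 hDc hinv).hasFDerivAt

/-- **(70)** «𝔇(A′) = (I + ℜ)⁻¹ L^{j(·)}η((δ/δA)C)(A′ − HD(A′))»: the functional derivative of `D` at `A′` IS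
`(I + ℜ)⁻¹𝒞′`. [cite: Balaban1985Variational, (70) p.289] -/
theorem eq70 (h49 : ∀ᶠ A'' in 𝓝 A', D A'' = 𝒞 (A'' - H (D A'')))
    (h𝒞 : HasStrictFDerivAt 𝒞 𝒞' (A' - H (D A'))) (hDc : ContinuousAt D A')
    (hinv : (1 + 𝒞' ∘L H).IsInvertible) :
    fderiv 𝕜 D A' = (1 + 𝒞' ∘L H).inverse ∘L 𝒞' :=
  (hasFDerivAt_of_eq49 h49 h𝒞 hDc hinv).fderiv

/-- (70) with (63): the directional derivatives are `(d/dτ)D(A′ + τδA′)|_{τ=0} = (I + ℜ)⁻¹𝒞′δA′`.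
[cite: Balaban1985Variational, (63) p.287, (70) p.289] -/
theorem eq70_line (h49 : ∀ᶠ A'' in 𝓝 A', D A'' = 𝒞 (A'' - H (D A'')))
    (h𝒞 : HasStrictFDerivAt 𝒞 𝒞' (A' - H (D A'))) (hDc : ContinuousAt D A')
    (hinv : (1 + 𝒞' ∘L H).IsInvertible) (δ : E) :
    HasDerivAt (fun τ : 𝕜 => D (A' + τ • δ)) ((1 + 𝒞' ∘L H).inverse (𝒞' δ)) 0 :=
  eq63 (hasFDerivAt_of_eq49 h49 h𝒞 hDc hinv) δ

/-- «Equation (68) is uniquely solvable by a convergent Neumann series»: for `‖ℜ‖ < 1` the operator `I + ℜ` is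
invertible (`F` complete). [cite: Balaban1985Variational, (70) p.289] -/
theorem isInvertible_one_add_of_norm_lt_one (ℜ : F →L[𝕜] F) (hℜ : ‖ℜ‖ < 1) : (1 + ℜ).IsInvertible := by
  have hn : ‖-ℜ‖ < 1 := by rwa [norm_neg]
  refine ContinuousLinearMap.IsInvertible.of_inverse (g := ∑' n : ℕ, (-ℜ) ^ n) ?_ ?_
  · have h := mul_neg_geom_series (-ℜ) hn
    rw [sub_neg_eq_add] at h
    rw [← ContinuousLinearMap.mul_def, h, ContinuousLinearMap.one_def]
  · have h := geom_series_mul_neg (-ℜ) hn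
    rw [sub_neg_eq_add] at h
    rw [← ContinuousLinearMap.mul_def, h, ContinuousLinearMap.one_def]

/-- The Neumann series: for `‖ℜ‖ < 1`, `(I + ℜ)⁻¹ = Σₙ (−ℜ)ⁿ`. [cite: Balaban1985Variational, (70) p.289] -/
theorem inverse_one_add_eq_tsum (ℜ : F →L[𝕜] F) (hℜ : ‖ℜ‖ < 1) :
    (1 + ℜ).inverse = ∑' n : ℕ, (-ℜ) ^ n := by
  have hn : ‖-ℜ‖ < 1 := by rwa [norm_neg]
  refine ContinuousLinearMap.inverse_eq ?_ ?_
  · have h := mul_neg_geom_series (-ℜ) hn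
    rw [sub_neg_eq_add] at h
    rw [← ContinuousLinearMap.mul_def, h, ContinuousLinearMap.one_def]
  · have h := geom_series_mul_neg (-ℜ) hn
    rw [sub_neg_eq_add] at h
    rw [← ContinuousLinearMap.mul_def, h, ContinuousLinearMap.one_def]

/-- **(70) by the Neumann series**: under (49) near `A′`, strict differentiability of `𝒞` at `X₀`, continuity of `D`
at `A′` and `‖ℜ‖ < 1`, `(δ/δA′)D(A′) = (Σₙ (−ℜ)ⁿ)𝒞′`. [cite: Balaban1985Variational, (70) p.289] -/
theorem eq70_neumann (h49 : ∀ᶠ A'' in 𝓝 A', D A'' = 𝒞 (A'' - H (D A'')))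
    (h𝒞 : HasStrictFDerivAt 𝒞 𝒞' (A' - H (D A'))) (hDc : ContinuousAt D A') (hℜ : ‖𝒞' ∘L H‖ < 1) :
    HasFDerivAt D ((∑' n : ℕ, (-(𝒞' ∘L H)) ^ n) ∘L 𝒞') A' := by
  have h := hasFDerivAt_of_eq49 h49 h𝒞 hDc (isInvertible_one_add_of_norm_lt_one _ hℜ)
  rwa [inverse_one_add_eq_tsum _ hℜ] at h

end Eq70

/-! ## §4 (64), (66): the kernel form -/
section Eq66

variable {𝕜 : Type*} [Field 𝕜] {ιE ιF : Type*} [Fintype ιE] [Fintype ιF] [DecidableEq ιE]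

/-- **(64)/(66)** «𝔇(A′; c, b) = (δ/δA′(b))D(A′, c) (64) … Lʲη(δC_j/δA(b))(Lʲη(A′ − HD(A′)), c) − LʲηΣ_{b′} η^d
(δC_j/δA(b′))(Lʲη(A′ − HD(A′)), c) Σ_{c′∈𝔅_k}(L^{j′}η)^d H(b′, c′)𝔇(A′; c′, b) = 𝔇(A′; c, b), c ∈ Λ_j, b ∈ Ω₀ (66)».
Kernels relative to the printed weighted pairings (`wE = η^d` on bonds of `Ω₀`, `wF = (L^{j′}η)^d` on `𝔅_k`): `Dk c b
= 𝔇(A′; c, b)` with `(𝔇f)(c) = Σ_b wE(b) Dk(c, b) f(b)` ((63)–(64)), `Hk` with `(Hg)(b′) = Σ_{c′} wF(c′) Hk(b′, c′) g(c′)`,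
`Ck c b′ = Lʲη(δC_j/δA(b′))(Lʲη(A′ − HD(A′)), c)` with `(𝒞′f)(c) = Σ_{b′} wE(b′) Ck(c, b′) f(b′)`.  Then (67) tested on
the basis field at `b` IS (66). [cite: Balaban1985Variational, (64) p.288, (66) p.288] -/
theorem eq66 (𝒞' 𝔇 : (ιE → 𝕜) → (ιF → 𝕜)) (H : (ιF → 𝕜) → (ιE → 𝕜)) (wE : ιE → 𝕜) (wF : ιF → 𝕜)
    (Ck : ιF → ιE → 𝕜) (Hk : ιE → ιF → 𝕜) (Dk : ιF → ιE → 𝕜)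
    (hCk : ∀ f c, 𝒞' f c = ∑ b', wE b' * Ck c b' * f b')
    (hHk : ∀ g b', H g b' = ∑ c', wF c' * Hk b' c' * g c')
    (hDk : ∀ f c, 𝔇 f c = ∑ b, wE b * Dk c b * f b) (hwE : ∀ b, wE b ≠ 0)
    (h67 : ∀ δ, 𝒞' δ - 𝒞' (H (𝔇 δ)) = 𝔇 δ) (c : ιF) (b : ιE) :
    Ck c b - ∑ b', wE b' * Ck c b' * ∑ c', wF c' * Hk b' c' * Dk c' b = Dk c b := by
  have h := congr_fun (h67 (Pi.single b 1)) c
  simp only [Pi.sub_apply] at h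
  rw [hCk, hCk, hDk] at h
  simp only [hHk, hDk, Pi.single_apply, mul_ite, mul_one, mul_zero, Finset.sum_ite_eq',
    Finset.mem_univ, if_true] at h
  -- `h : wE b * Ck c b - Σ_{b'} wE b' * Ck c b' * Σ_{c'} wF c' * Hk b' c' * (wE b * Dk c' b) = wE b * Dk c b`
  have key : wE b * (Ck c b - ∑ b', wE b' * Ck c b' * ∑ c', wF c' * Hk b' c' * Dk c' b) = wE b * Dk c b := by
    rw [← h, mul_sub, Finset.mul_sum]
    congr 1
    refine Finset.sum_congr rfl fun b' _ => ?_
    rw [Finset.mul_sum, Finset.mul_sum, Finset.mul_sum]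
    refine Finset.sum_congr rfl fun c' _ => ?_
    ring
  exact mul_left_cancel₀ (hwE b) key

end Eq66

/-! ## §5 (69): the Cauchy step -/
section Eq69

variable {𝒴 𝒳 : Type*} [NormedAddCommGroup 𝒴] [NormedSpace ℂ 𝒴] [NormedAddCommGroup 𝒳] [NormedSpace ℂ 𝒳]

/-- **(69), the printed radius**: `r = ε₃(B₀(L^{j′}η)^{−d}e^{−δ₀d(c₋,c′₋)})⁻¹ = ε₃/M` with `M = B₀(L^{j′}η)^{−d}
e^{−δ₀d(c₋,c′₋)}`, and the arithmetic `(1/r)C₂(2ε₃ + rM)² = 9C₂ε₃M` of the last equality of (69).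
[cite: Balaban1985Variational, (69) p.288] -/
theorem radius69 {C₂ ε₃ M : ℝ} (hε₃ : 0 < ε₃) (hM : 0 < M) :
    (1 / (ε₃ * M⁻¹)) * (C₂ * (2 * ε₃ + (ε₃ * M⁻¹) * M) ^ 2) = 9 * C₂ * ε₃ * M := by
  field_simp
  ring

/-- **(69), the Cauchy step** (lines 2–5): if `f(τ) = C_j(X₀ + τh, c)` is holomorphic on a neighbourhood of the closed disc
`|τ| ≤ r` and bounded on the circle `|τ| = r` by the printed `C₂(2ε₃ + rM)²`, then with the printed radius `r = ε₃/M`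
Cauchy's estimate gives `‖f′(0)‖ ≤ (1/r)C₂(2ε₃ + rM)² = 9C₂ε₃M` (Mathlib `Complex.norm_deriv_le_of_forall_mem_sphere_norm_le`
= the contour integral `(1/2πi)∮ τ⁻² f` estimate of line 2). [cite: Balaban1985Variational, (69) p.288] -/
theorem norm_deriv_le_69 {f : ℂ → 𝒳} {r C₂ ε₃ M : ℝ} (hε₃ : 0 < ε₃) (hM : 0 < M) (hr : r = ε₃ / M)
    (hf : DiffContOnCl ℂ f (ball (0 : ℂ) r)) (hb : ∀ τ ∈ sphere (0 : ℂ) r, ‖f τ‖ ≤ C₂ * (2 * ε₃ + r * M) ^ 2) :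
    ‖deriv f 0‖ ≤ 9 * C₂ * ε₃ * M := by
  have hr0 : 0 < r := by rw [hr]; positivity
  have h := Complex.norm_deriv_le_of_forall_mem_sphere_norm_le hr0 hf hb
  calc ‖deriv f 0‖ ≤ C₂ * (2 * ε₃ + r * M) ^ 2 / r := h
    _ = 9 * C₂ * ε₃ * M := by rw [hr]; field_simp; ring

open B13Contraction113 (QuadAnalytic)

/-- **(69) from the printed inputs**: with `C_j` satisfying «|C_j(X)| ≦ C₂|X|²» and analytic on `‖X‖ < R` ([4] Props.
4/7, `B13Contraction113.QuadAnalytic`), `‖X₀‖ ≤ 2ε₃` (`X₀ = Lʲη(A′ − HD(A′))`, by (57)), `‖h‖ ≤ M` (`h = H(·, c′)`,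
`M = B₀(L^{j′}η)^{−d}e^{−δ₀d(c₋,c′₋)}` by Thm. 3.12 of [5]) and `3ε₃ < R` (the circle `|τ| = r = ε₃/M` keeps the
argument in the ball: `‖X₀ + τh‖ ≤ 2ε₃ + rM = 3ε₃`): `‖(d/dτ)C_j(X₀ + τh)|_{τ=0}‖ ≤ 9C₂ε₃M`.
[cite: Balaban1985Variational, (69) p.288] -/
theorem ineq69 {C : 𝒴 → 𝒳} {C₂ R ε₃ M : ℝ} (hC : QuadAnalytic C C₂ R) (hC₂ : 0 ≤ C₂) {X₀ h : 𝒴}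
    (hε₃ : 0 < ε₃) (hM : 0 < M) (hX₀ : ‖X₀‖ ≤ 2 * ε₃) (hh : ‖h‖ ≤ M) (hR : 3 * ε₃ < R) :
    ‖deriv (fun τ : ℂ => C (X₀ + τ • h)) 0‖ ≤ 9 * C₂ * ε₃ * M := by
  set r : ℝ := ε₃ / M with hr
  have hr0 : 0 < r := by positivity
  have hrM : r * M = ε₃ := by rw [hr]; field_simp
  -- on the closed disc the argument stays in the ball `‖X‖ < R`
  have harg : ∀ τ : ℂ, ‖τ‖ ≤ r → ‖X₀ + τ • h‖ ≤ 2 * ε₃ + r * M := by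
    intro τ hτ
    calc ‖X₀ + τ • h‖ ≤ ‖X₀‖ + ‖τ • h‖ := norm_add_le _ _
      _ = ‖X₀‖ + ‖τ‖ * ‖h‖ := by rw [norm_smul]
      _ ≤ 2 * ε₃ + r * M := by gcongr
  have hargR : ∀ τ : ℂ, ‖τ‖ ≤ r → ‖X₀ + τ • h‖ < R := fun τ hτ =>
    (harg τ hτ).trans_lt (by rw [hrM]; linarith)
  -- holomorphy on a neighbourhood of the closed disc
  have hdiff : DiffContOnCl ℂ (fun τ : ℂ => C (X₀ + τ • h)) (ball (0 : ℂ) r) := by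
    refine DifferentiableOn.diffContOnCl ?_
    rw [closure_ball (0 : ℂ) hr0.ne']
    refine (hC.lineAnalytic X₀ h).mono ?_
    intro τ hτ
    rw [mem_closedBall, dist_zero_right] at hτ
    exact hargR τ hτ
  -- the bound on the circle
  have hb : ∀ τ ∈ sphere (0 : ℂ) r, ‖C (X₀ + τ • h)‖ ≤ C₂ * (2 * ε₃ + r * M) ^ 2 := by
    intro τ hτ
    rw [mem_sphere, dist_zero_right] at hτ
    calc ‖C (X₀ + τ • h)‖ ≤ C₂ * ‖X₀ + τ • h‖ ^ 2 := hC.quad _ (hargR τ hτ.le)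
      _ ≤ C₂ * (2 * ε₃ + r * M) ^ 2 := by
          gcongr
          exact harg τ hτ.le
  exact norm_deriv_le_69 hε₃ hM hr hdiff hb

/-- **(69) as printed**, last member: `9C₂B₀ε₃(L^{j′}η)^{−d}e^{−δ₀d(c₋,c′₋)}` — `ineq69` with `M = B₀ t^{−d} e^{−δ₀·dcc′}`,
`t = L^{j′}η`. [cite: Balaban1985Variational, (69) p.288] -/
theorem ineq69_printed {C : 𝒴 → 𝒳} {C₂ R ε₃ B₀ t δ₀ dcc' : ℝ} {d : ℕ} (hC : QuadAnalytic C C₂ R) (hC₂ : 0 ≤ C₂)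
    {X₀ h : 𝒴} (hε₃ : 0 < ε₃) (hB₀ : 0 < B₀) (ht : 0 < t) (hX₀ : ‖X₀‖ ≤ 2 * ε₃)
    (hh : ‖h‖ ≤ B₀ * t ^ (-(d : ℝ)) * Real.exp (-(δ₀ * dcc'))) (hR : 3 * ε₃ < R) :
    ‖deriv (fun τ : ℂ => C (X₀ + τ • h)) 0‖ ≤
      9 * C₂ * B₀ * ε₃ * t ^ (-(d : ℝ)) * Real.exp (-(δ₀ * dcc')) := by
  have hM : 0 < B₀ * t ^ (-(d : ℝ)) * Real.exp (-(δ₀ * dcc')) := by positivity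
  have hmain := ineq69 hC hC₂ hε₃ hM hX₀ hh hR
  calc ‖deriv (fun τ : ℂ => C (X₀ + τ • h)) 0‖
        ≤ 9 * C₂ * ε₃ * (B₀ * t ^ (-(d : ℝ)) * Real.exp (-(δ₀ * dcc'))) := hmain
    _ = 9 * C₂ * B₀ * ε₃ * t ^ (-(d : ℝ)) * Real.exp (-(δ₀ * dcc')) := by ring

/-- **(69), line 1**: «|(Lʲη⟨(δC_j/δA)(Lʲη(A′ − HD(A′))), H⟩)(c, c′)| = |(d/dτ)C_j(Lʲη(A′ − HD(A′)) + τH(·, c′), c)|_{τ=0}|»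
— the entry of `𝒞′ ∘ H` against the column `h = H(·, c′)` is the line derivative (63) of `C` at `X₀` in the direction
`h`. [cite: Balaban1985Variational, (69) p.288] -/
theorem eq69_line1 {C : 𝒴 → 𝒳} {C' : 𝒴 →L[ℂ] 𝒳} {X₀ : 𝒴} (hC : HasFDerivAt C C' X₀) (h : 𝒴) :
    deriv (fun τ : ℂ => C (X₀ + τ • h)) 0 = C' h :=
  eq63_deriv hC h

/-- **(69), line 2**: «= |(1/2πi) ∮_{|τ|=r} dτ τ⁻² C_j(… + τH(·, c′), c)|» — Cauchy's formula for the derivative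
(Mathlib), for `f` holomorphic on an open set containing the closed disc. [cite: Balaban1985Variational, (69) p.288] -/
theorem eq69_cauchyFormula [CompleteSpace 𝒳] {f : ℂ → 𝒳} {U : Set ℂ} (hU : IsOpen U) {r : ℝ} (hr : 0 < r)
    (hsub : closedBall (0 : ℂ) r ⊆ U) (hf : DifferentiableOn ℂ f U) :
    deriv f 0 = (2 * Real.pi * Complex.I : ℂ)⁻¹ • ∮ τ in C(0, r), ((τ - 0) ^ 2)⁻¹ • f τ :=
  (Complex.two_pi_I_inv_smul_circleIntegral_sub_sq_inv_smul_of_differentiable hU hsub hf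
    (mem_ball_self hr)).symm

end Eq69

end Literature.MathematicalPhysics.QuantumFieldTheory.Balaban1983to89.B11Eq63FunctionalDerivative
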